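import Summits.ValiantsHypothesis.ValiantsHypothesis.Theses.FeketeSOS
import Summits.ValiantsHypothesis.ValiantsHypothesis.Theorems.SOSMagnification.Negative.FeketeHardDeltaRange

/-!
# `SOSMagnification` / `FeketeSOSHard` — negative lemmas: the two-squares layer of X

Crux `stmt-ValiantsHypothesis-3995` (`FeketeSOS.SOSMagnification`) is literally
`FeketeSOSHard → ValiantsHypothesis`; its hypothesis X = `FeketeSOSHard` quantifies over weighted-SOS
representations `F_p = ∑_{i<s} cᵢ gᵢ²` of the Fekete polynomial `F_p = ∑_{m<p} (m|p) X^m ∈ ℂ[X]`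
with `s ≤ p^δ` squares of degree `≤ p²`.  This file records the small-model structure of that
universal (standing-disprover findings, cycle 2; work file `Cruxes/SOSMagnification/Disproof.lean`):

* `C_mul_sq_ne_fekete`, `two_le_of_feketeRep`: no representation with `s ≤ 1` squares exists
  (`x = 0` is a simple root of `F_p`), so the universal of X is inhabited exactly from `s = 2` on
  (the dense representation `two_squares` of `FeketeHardDeltaRange`);
* `natDegree_lt_of_two_squares_fekete`: LOAD-BEARING ANALYSIS of the side condition
  `∀ i, natDegree (g i) ≤ p²` — for two squares it is decoration: both `gᵢ` automatically have degree
  `< p`, because `c₀g₀² + c₁g₁² = (a g₀ + b g₁)(a g₀ − b g₁)` (`a² = c₀`, `b² = −c₁`, both weights being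
  nonzero) is a factorisation of `F_p`; so the `s ≤ 2` layer of X is the sparse-splitting statement
  `FeketeNoSparseSplit` (via `SplitOfTwoSquares`) with no side condition at all;
* `exists_three_squares_fekete_natDegree_gt`: from three squares on the degree condition is a genuine
  restriction — there are three-square representations with a square of arbitrarily large degree.

References: P. Dutta, N. Saxena, T. Thierauf, comput. complexity 33 (2024), Def. 1.1, eq. (3)
[DuttaSaxenaThierauf2024] (the weighted-SOS model); the lemmas themselves are folklore algebra.
-/

namespace Summit.ValiantsHypothesis.ValiantsHypothesis.Theorems.SOSMagnification.Negative

set_option linter.dupNamespace false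

open Polynomial
open scoped BigOperators

/-- Coefficients of the Fekete polynomial. [folklore] -/
theorem coeff_fekete (p : ℕ) [Fact p.Prime] (n : ℕ) :
    ((∑ m ∈ Finset.range p, C ((legendreSym p m : ℤ) : ℂ) * X ^ m)).coeff n = if n < p then (((legendreSym p n : ℤ)) : ℂ) else 0 := by
  simp only [finsetSum_coeff, coeff_C_mul_X_pow]
  split_ifs with h
  · rw [Finset.sum_eq_single n]
    · simp
    · intro b _ hb; simp [Ne.symm hb]
    · intro hn; exact absurd (Finset.mem_range.2 h) hn
  · refine Finset.sum_eq_zero fun b hb => ?_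
    have : b < p := Finset.mem_range.1 hb
    simp [show n ≠ b by omega]

/-- `F_p(0) = 0`. [folklore] -/
theorem coeff_fekete_zero (p : ℕ) [Fact p.Prime] : ((∑ m ∈ Finset.range p, C ((legendreSym p m : ℤ) : ℂ) * X ^ m)).coeff 0 = 0 := by
  rw [coeff_fekete]; simp

/-- `F_p'(0) = (1|p) = 1`. [folklore] -/
theorem coeff_fekete_one (p : ℕ) [Fact p.Prime] : ((∑ m ∈ Finset.range p, C ((legendreSym p m : ℤ) : ℂ) * X ^ m)).coeff 1 = 1 := by
  rw [coeff_fekete, if_pos (Fact.out : p.Prime).one_lt]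
  simp

/-- `F_p ≠ 0`. [folklore] -/
theorem fekete_ne_zero (p : ℕ) [Fact p.Prime] : (∑ m ∈ Finset.range p, C ((legendreSym p m : ℤ) : ℂ) * X ^ m) ≠ 0 := by
  intro h
  have := coeff_fekete_one p
  rw [h, coeff_zero] at this
  exact zero_ne_one this

/-- **No single weighted square is `F_p`**: `x = 0` is a simple root (`F_p(0) = 0`, `F_p'(0) = 1`).
[folklore] -/
theorem C_mul_sq_ne_fekete (p : ℕ) [Fact p.Prime] (c : ℂ) (g : Polynomial ℂ) :
    C c * g ^ 2 ≠ (∑ m ∈ Finset.range p, C ((legendreSym p m : ℤ) : ℂ) * X ^ m) := by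
  intro h
  have h0 := congrArg (fun q => q.coeff 0) h
  have h1 := congrArg (fun q => q.coeff 1) h
  simp only [coeff_C_mul, coeff_fekete_zero, coeff_fekete_one] at h0 h1
  rw [pow_two, mul_coeff_zero] at h0
  rcases mul_eq_zero.1 h0 with hc | hg
  · rw [hc, zero_mul] at h1; exact zero_ne_one h1
  · have hg0 : g.coeff 0 = 0 := by rcases mul_eq_zero.1 hg with h' | h' <;> exact h'
    obtain ⟨q, rfl⟩ := Polynomial.X_dvd_iff.2 hg0
    have h2 : ((X * q) ^ 2).coeff 1 = 0 := by
      rw [show (X * q) ^ 2 = q ^ 2 * X ^ 2 by ring, coeff_mul_X_pow']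
      simp
    rw [h2, mul_zero] at h1
    exact zero_ne_one h1

/-- **Small-model fact: at least two squares.** Every weighted-SOS representation of `F_p` has
`s ≥ 2`; with `two_squares` the universal of X at a prime `p` is inhabited iff `p ^ δ ≥ 2`. [folklore] -/
theorem two_le_of_feketeRep (p : ℕ) [Fact p.Prime] {s : ℕ} (c : Fin s → ℂ)
    (g : Fin s → Polynomial ℂ) (h : (∑ i, C (c i) * g i ^ 2) = (∑ m ∈ Finset.range p, C ((legendreSym p m : ℤ) : ℂ) * X ^ m)) : 2 ≤ s := by
  rcases Nat.lt_or_ge s 2 with hs | hs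
  · interval_cases s
    · simp only [Finset.univ_eq_empty, Finset.sum_empty] at h
      have h1 := congrArg (fun q => q.coeff 1) h
      simp only [coeff_zero, coeff_fekete_one] at h1
      exact absurd h1 zero_ne_one
    · rw [Fin.sum_univ_one] at h
      exact absurd h (C_mul_sq_ne_fekete p _ _)
  · exact hs

/-- **The degree side condition of X is decoration for two squares.** In any representation of
`F_p` by two weighted squares both `gᵢ` have degree `< p` (hence `≤ p²`): both weights are nonzero
(`C_mul_sq_ne_fekete`), `c₀g₀² + c₁g₁² = (a g₀ + b g₁)(a g₀ − b g₁)` with `a² = c₀`, `b² = −c₁`, the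
two factors have degrees summing to `deg F_p < p`, and `g₀ = (A+B)/2a`, `g₁ = (A−B)/2b`. [folklore] -/
theorem natDegree_lt_of_two_squares_fekete (p : ℕ) [Fact p.Prime] (c : Fin 2 → ℂ)
    (g : Fin 2 → Polynomial ℂ) (h : (∑ i, C (c i) * g i ^ 2) = (∑ m ∈ Finset.range p, C ((legendreSym p m : ℤ) : ℂ) * X ^ m)) :
    ∀ i, (g i).natDegree < p := by
  simp only [Fin.sum_univ_two] at h
  have hc0 : c 0 ≠ 0 := by
    intro h0; rw [h0, map_zero, zero_mul, zero_add] at h; exact C_mul_sq_ne_fekete p _ _ h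
  have hc1 : c 1 ≠ 0 := by
    intro h0; rw [h0, map_zero, zero_mul, add_zero] at h; exact C_mul_sq_ne_fekete p _ _ h
  obtain ⟨a, ha⟩ := IsAlgClosed.exists_eq_mul_self (c 0)
  obtain ⟨b, hb⟩ := IsAlgClosed.exists_eq_mul_self (-c 1)
  have ha0 : a ≠ 0 := by rintro rfl; exact hc0 (by rw [ha, mul_zero])
  have hb0 : b ≠ 0 := by rintro rfl; apply hc1; have := hb; simp at this; exact this
  set A := C a * g 0 + C b * g 1 with hA
  set B := C a * g 0 - C b * g 1 with hB
  have hAB : A * B = (∑ m ∈ Finset.range p, C ((legendreSym p m : ℤ) : ℂ) * X ^ m) := by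
    rw [← h, hA, hB]
    have e0 : C (c 0) = C a * C a := by rw [← C_mul, ← ha]
    have e1 : C (c 1) = -(C b * C b) := by rw [← C_mul, ← hb, map_neg, neg_neg]
    rw [e0, e1]; ring
  have hA0 : A ≠ 0 := by intro h0; rw [h0, zero_mul] at hAB; exact fekete_ne_zero p hAB.symm
  have hB0 : B ≠ 0 := by intro h0; rw [h0, mul_zero] at hAB; exact fekete_ne_zero p hAB.symm
  have hsum : A.natDegree + B.natDegree < p := by
    rw [← natDegree_mul hA0 hB0, hAB]; exact natDegree_fekete_lt p
  have hg0 : g 0 = C (2 * a)⁻¹ * (A + B) := by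
    rw [hA, hB]
    have : C (2 * a)⁻¹ * (C a * g 0 + C b * g 1 + (C a * g 0 - C b * g 1))
        = C ((2 * a)⁻¹ * (2 * a)) * g 0 := by rw [C_mul, C_mul]; simp only [map_ofNat]; ring
    rw [this, inv_mul_cancel₀ (mul_ne_zero two_ne_zero ha0), C_1, one_mul]
  have hg1 : g 1 = C (2 * b)⁻¹ * (A - B) := by
    rw [hA, hB]
    have : C (2 * b)⁻¹ * (C a * g 0 + C b * g 1 - (C a * g 0 - C b * g 1))
        = C ((2 * b)⁻¹ * (2 * b)) * g 1 := by rw [C_mul, C_mul]; simp only [map_ofNat]; ring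
    rw [this, inv_mul_cancel₀ (mul_ne_zero two_ne_zero hb0), C_1, one_mul]
  have hApB : (A + B).natDegree < p :=
    lt_of_le_of_lt (natDegree_add_le _ _) (max_lt (by omega) (by omega))
  have hAmB : (A - B).natDegree < p :=
    lt_of_le_of_lt (natDegree_sub_le _ _) (max_lt (by omega) (by omega))
  intro i
  fin_cases i
  · show (g 0).natDegree < p
    rw [hg0]; exact lt_of_le_of_lt (natDegree_C_mul_le _ _) hApB
  · show (g 1).natDegree < p
    rw [hg1]; exact lt_of_le_of_lt (natDegree_C_mul_le _ _) hAmB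

/-- **From three squares on the degree side condition genuinely restricts**: `F_p` has
three-square representations with a square of arbitrarily large degree (`g₂ = X^{N+1}`,
`g₀, g₁ = F_p − g₂² ± 1`, weights `¼, −¼, 1`). [folklore] -/
theorem exists_three_squares_fekete_natDegree_gt (p : ℕ) [Fact p.Prime] (N : ℕ) :
    ∃ (c : Fin 3 → ℂ) (g : Fin 3 → Polynomial ℂ),
      (∑ i, C (c i) * g i ^ 2) = (∑ m ∈ Finset.range p, C ((legendreSym p m : ℤ) : ℂ) * X ^ m) ∧ N < (g 2).natDegree := by
  refine ⟨![(4 : ℂ)⁻¹, -(4 : ℂ)⁻¹, 1],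
    ![(∑ m ∈ Finset.range p, C ((legendreSym p m : ℤ) : ℂ) * X ^ m) - X ^ (2 * (N + 1)) + 1, (∑ m ∈ Finset.range p, C ((legendreSym p m : ℤ) : ℂ) * X ^ m) - X ^ (2 * (N + 1)) - 1, X ^ (N + 1)], ?_, ?_⟩
  · simp only [Fin.sum_univ_three, Matrix.cons_val_zero, Matrix.cons_val_one, Matrix.cons_val_two,
      Matrix.head_cons, Matrix.tail_cons]
    have h4 : (C (4 : ℂ)⁻¹ : Polynomial ℂ) * 4 = 1 := by
      rw [← map_ofNat C 4, ← C_mul, inv_mul_cancel₀ (by norm_num), C_1]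
    rw [map_neg, map_one, ← pow_mul, mul_comm (N + 1) 2]
    linear_combination ((∑ m ∈ Finset.range p, C ((legendreSym p m : ℤ) : ℂ) * X ^ m) - X ^ (2 * (N + 1))) * h4
  · simp only [Matrix.cons_val_two, Matrix.tail_cons, Matrix.head_cons, natDegree_X_pow]
    omega

end Summit.ValiantsHypothesis.ValiantsHypothesis.Theorems.SOSMagnification.Negative
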